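/-
b2b-lace packet, TAIL-BOUND ANALYST gen 11 (unit `b2b-lace-tail-g11`).  (S2b)-IMPR TABLE-SIDE KIT (T5): the NEAR/FAR SPLIT of the cell
`𝒳 = {‖x‖₂ > 1} = {‖x‖₁ = 2} ∪ {‖x‖₁ ≥ 3}` for the `f₃` numerator at the true SRW tables — `W_d`-invariance of every true entry and of
`boundHD75 (srwTrue d α̲ ᾱ) n l · a`, the two-orbit structure of the shell `‖x‖₁ = 2` (POINTWISE reading at `2e₁`, `e₁+e₂`), the far cell
`Q = {‖x‖₁ ≥ 3}` (three-node reduction of `I`), and the generic-cell / at-a-node forms of the cell theorems of `F3BoundsCellReduction`.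
`d`-generic; additive; no numeral of any dimension; everything proved.
-/
import Literature.Probability.FitznerVanDerHofstad2017.F3BoundsCellReduction
import HarnessLib

/-!
# Near/far split of the `f₃` cells at the true SRW tables

CITATION HEADER (PLACEMENT v2). Part of a certified REPRODUCTION of R. Fitzner, R. van der Hofstad, *Generalized approach to the
non-backtracking lace expansion*, PTRF **169** (2017) 1041–1119 [NoBLE17], §3.3.5 (3.87) p. 1079 and §5.1 p. 1093, and of R. Fitzner,
R. van der Hofstad, *Mean-field behavior for nearest-neighbor percolation in `d > 10`*, EJP **22** (2017) no. 43 [FvdH17], §2.5 with the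
notebook `Percolation.nb` (the cells over `𝒳` are evaluated as the maximum of the POINTWISE values at the points of `𝒳` with `‖x‖₁ ≤ 2` and of
the bound over `Q = {‖x‖₁ ≥ 3}` read at "the minimal elements of `Q`"):

> [NoBLE17] p. 1079: "the supremum over `S` is attained at one of the lowest-order points of `S`, as all involved functions are monotone
> decreasing in the absolute value of each coordinate"; p. 1093: "By symmetry … it suffices to consider the minimal elements of `Q`,
> i.e., `3e₁`, `2e₁ + e₂` and `e₁ + e₂ + e₃`"; (3.35)–(3.38): the SRW integrals are functions of the symmetrised `D̂^{(x)}`.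

## What is here (all proved, `d`-generic)

§1 `𝒳` as an `ℓ¹` condition: `mem_calX_iff_two_le_sum_abs` (`x ∈ 𝒳 ↔ ‖x‖₁ ≥ 2` on `ℤ^d`) and the split
   `forall_mem_calX_iff_shell_and_Q : (∀ x ∈ 𝒳, P x) ↔ (∀ x, ‖x‖₁ = 2 → P x) ∧ (∀ x, ‖x‖₁ ≥ 3 → P x)`.
§2 `W_d`-INVARIANCE of every true entry: `srwU_spAct`, `srwTS_spAct`, `spInvariant_shift2Sum`, `spInvariant_srwIShift2` (with
   `spInvariant_srwI`, `srwJ_spAct`, `srwK_spAct` of the tree), hence `srwTrue_frozenAt_spAct` and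
   **`boundHD75_srwTrue_spAct : boundHD75 (srwTrue d α̲ ᾱ) n l (σx) a = boundHD75 (srwTrue d α̲ ᾱ) n l x a`**.
§3 The SHELL `‖x‖₁ = 2` has two `W_d`-orbits: `shell_two_orbit` (every `W_d`-invariant `F` takes at `x` its value at `2e₁` or at `e₁+e₂`),
   `le_of_sum_abs_eq_two`; hence **`boundHD75_srwTrue_shell_le`**: the pointwise cell inequality on the shell from its two values at
   `vecOfParts d [2] = 2e₁` and `classVec d 2 0 = e₁+e₂`, and **`boundHD75_srwTrue_calX_le_of_nodes_of_Q`**: the cell over `𝒳` from those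
   two values and the cell over `Q`.
§4 The FAR CELL `Q`: `srwI_le_max3_of_three_le_sum_abs` (`I_{n,l}(x) ≤ max (I(3e₁), I(2e₁+e₂), I(e₁+e₂+e₃))` on `Q`; the nodes `2e₁+2e₂`,
   `1^r` (`r ≥ 4`) of `SrwIntegralSortedMonotone.le_of_nodeBounds_three` are removed by coordinatewise monotonicity), `srwI_le_of_nodeBounds_Q`.
   (`S_{p,l}` on `Q`: the two-entry bound of `SrwIntegralIShiftCellSup` over `‖x‖₁ ≥ 2 ⊇ Q` applies verbatim.)
§5 GENERIC-CELL and AT-A-NODE forms of the cell theorems (namespace `F3Bounds`): `boundHD75_srwTrue_zero_le_on C` / `_one_le_on C` (any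
   `C : Set ℤ^d`; entrywise sup hypotheses over `C` in the shapes of `NobleF3TrueTables.srwTrue_IM_natCast_le` / `_negOne_le`) and
   `boundHD75_srwTrue_zero_at_le` / `_one_at_le` (entry VALUES at one node `y`) — with §3 these give the notebook's reading of the six cells.

## What is NOT here
No dimension, no table, no numeric value, no certificate; no statement about `d ≠` anything.
-/

noncomputable section

namespace Literature.Probability.FitznerVanDerHofstad2017

open Finset Real
open Literature.Barriers.CriticalPhenomena Literature.Probability.LatticeModels

variable {d : ℕ}

/-! ### §1  `𝒳` as an `ℓ¹` condition and the near/far split -/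

/-- `‖x‖₁ ≥ 2` implies `x ∈ 𝒳 = {‖x‖₂ > 1}` on `ℤ^d` (`|n| ≤ n²` for integers). [cite: FitznerVanDerHofstad2017, (2.23) (the set `𝒳`)] -/
theorem mem_calX_of_two_le_sum_abs (x : Fin d → ℤ) (hx : 2 ≤ ∑ j, |x j|) : x ∈ calX d := by
  have habs : ∀ n : ℤ, |n| ≤ n ^ 2 := fun n => by
    rcases eq_or_ne n 0 with rfl | hn
    · simp
    · calc |n| = |n| * 1 := (mul_one _).symm
        _ ≤ |n| * |n| := mul_le_mul_of_nonneg_left (Int.one_le_abs hn) (abs_nonneg _)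
        _ = n ^ 2 := by rw [← sq, sq_abs]
  have hZ : (2 : ℤ) ≤ ∑ j, x j ^ 2 := hx.trans (Finset.sum_le_sum fun j _ => habs (x j))
  have hR : (2 : ℝ) ≤ ∑ j, ((x j : ℤ) : ℝ) ^ 2 := by exact_mod_cast hZ
  show 1 < euclidNorm x
  unfold euclidNorm
  rw [show (1 : ℝ) = Real.sqrt 1 from Real.sqrt_one.symm]
  exact Real.sqrt_lt_sqrt (by norm_num) (by linarith)

/-- `x ∈ 𝒳 ↔ ‖x‖₁ ≥ 2` on `ℤ^d`. [cite: FitznerVanDerHofstad2017, (2.23) (the set `𝒳`)] -/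
theorem mem_calX_iff_two_le_sum_abs (x : Fin d → ℤ) : x ∈ calX d ↔ 2 ≤ ∑ j, |x j| :=
  ⟨two_le_sum_abs_of_mem_calX x, mem_calX_of_two_le_sum_abs x⟩

/-- **The near/far split of `𝒳`**: a statement over `𝒳` is the conjunction of the statement on the shell `‖x‖₁ = 2` and on `Q = {‖x‖₁ ≥ 3}`.
[cite: FitznerVanDerHofstad2016NoBLE, §3.3.5 (3.87) p. 1079; §5.1 p. 1093 (the set `Q`)] [cite: FitznerVanDerHofstad2017, §2.5, notebook Percolation.nb] -/
theorem forall_mem_calX_iff_shell_and_Q {P : (Fin d → ℤ) → Prop} :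
    (∀ x ∈ calX d, P x) ↔ (∀ x : Fin d → ℤ, ∑ j, |x j| = 2 → P x) ∧ (∀ x : Fin d → ℤ, 3 ≤ ∑ j, |x j| → P x) := by
  constructor
  · intro h
    exact ⟨fun x hx => h x (mem_calX_of_two_le_sum_abs x hx.ge), fun x hx => h x (mem_calX_of_two_le_sum_abs x (by omega))⟩
  · rintro ⟨h2, h3⟩ x hx
    have h := two_le_sum_abs_of_mem_calX x hx
    rcases h.eq_or_lt with h | h
    · exact h2 x h.symm
    · exact h3 x (by omega)

/-! ### §2  `W_d`-invariance of the true entries -/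

/-- `U_{n,l}(σx) = U_{n,l}(x)` (`U` is a function of the symmetrised `D̂^{(x)}`). [cite: FitznerVanDerHofstad2016NoBLE, (3.38) p. 1071] -/
theorem srwU_spAct (n l : ℕ) (τ : SgnPermPair d) (x : Fin d → ℤ) : srwU d n l (spAct τ x) = srwU d n l x := by
  unfold srwU
  simp_rw [DhatSym_spAct]

/-- `U_{n,l}` is `W_d`-invariant. [cite: FitznerVanDerHofstad2016NoBLE, (3.38) p. 1071] -/
theorem spInvariant_srwU (n l : ℕ) : SpInvariant (srwU d n l) := fun τ x => srwU_spAct n l τ x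

/-- `T^{(5.11)}_{m,l}(σx) = T^{(5.11)}_{m,l}(x)`. [cite: FitznerVanDerHofstad2016NoBLE, (3.36)–(3.38) p. 1071, (5.11)] -/
theorem srwTS_spAct (a : ℝ) (m l : ℕ) (τ : SgnPermPair d) (x : Fin d → ℤ) :
    srwTS d a m l (spAct τ x) = srwTS d a m l x := by
  unfold srwTS
  rw [srwK_spAct, srwU_spAct]

/-- `𝒥_{N,l}` is `W_d`-invariant. [cite: FitznerVanDerHofstad2016NoBLE, (3.35) p. 1071; §3.5.1] -/
theorem spInvariant_srwJ (N l : ℕ) : SpInvariant (srwJ d N l) := fun τ x => srwJ_spAct N l τ x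

/-- `K_{n,l}` is `W_d`-invariant. [cite: FitznerVanDerHofstad2016NoBLE, (3.36) p. 1071] -/
theorem spInvariant_srwK (n l : ℕ) : SpInvariant (srwK d n l) := fun τ x => srwK_spAct n l τ x

/-- The shift sum `Σ_ι (F(x+2e_ι) + F(x−2e_ι))` of a `W_d`-invariant `F` is `W_d`-invariant (a signed permutation permutes the `2d` shifted
points `x ± 2e_ι`). [cite: FitznerVanDerHofstad2016NoBLE, (3.30) p. 1070; (3.35) p. 1071] -/
theorem spInvariant_shift2Sum {F : (Fin d → ℤ) → ℝ} (hI : SpInvariant F) : SpInvariant (shift2Sum F) := by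
  intro τ x
  unfold shift2Sum
  have hshift : ∀ (ι : Fin d) (s : ℤ), spAct τ x + axisVec ι s = spAct τ (x + axisVec (τ.1 ι) ((τ.2 ι : ℤ) * s)) := by
    intro ι s
    have hu : (τ.2 ι : ℤ) * (τ.2 ι : ℤ) = 1 := by
      rcases Int.units_eq_one_or (τ.2 ι) with h | h <;> simp [h]
    funext μ
    rw [Pi.add_apply, spAct_apply, spAct_apply, Pi.add_apply, axisVec_apply', axisVec_apply', mul_add]
    by_cases hμ : μ = ι
    · subst hμ; rw [if_pos rfl, if_pos rfl, ← mul_assoc, hu, one_mul]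
    · rw [if_neg hμ, if_neg (fun h => hμ (τ.1.injective h)), mul_zero]
  have hpair : ∀ ι : Fin d, F (spAct τ x + axisVec ι 2) + F (spAct τ x - axisVec ι 2) =
      F (x + axisVec (τ.1 ι) 2) + F (x - axisVec (τ.1 ι) 2) := by
    intro ι
    rw [sub_axisVec_eq_add (spAct τ x) ι 2, hshift ι 2, hshift ι (-2), hI, hI, sub_axisVec_eq_add x (τ.1 ι) 2]
    rcases Int.units_eq_one_or (τ.2 ι) with h | h
    · rw [h, Units.val_one, one_mul, one_mul]
    · rw [h, Units.val_neg, Units.val_one, neg_one_mul, neg_one_mul, neg_neg, add_comm]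
  rw [Finset.sum_congr rfl fun ι _ => hpair ι]
  exact Equiv.sum_comp τ.1 (fun κ => F (x + axisVec κ 2) + F (x - axisVec κ 2))

/-- `S_{p,l}` is `W_d`-invariant. [cite: FitznerVanDerHofstad2016NoBLE, (3.30) p. 1070; (3.35) p. 1071] -/
theorem spInvariant_srwIShift2 (p l : ℕ) : SpInvariant (srwIShift2 d p l) := fun τ x => by
  rw [srwIShift2_eq_shift2Sum, srwIShift2_eq_shift2Sum]
  exact spInvariant_shift2Sum (spInvariant_srwI p l) τ x

/-- A `W_d`-invariant `F` depends only on the coordinatewise absolute values. [cite: FitznerVanDerHofstad2016NoBLE, Def. 2.5 p. 1058; (3.35)] -/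
theorem eq_abs_of_spInvariant {F : (Fin d → ℤ) → ℝ} (hI : SpInvariant F) (x : Fin d → ℤ) : F x = F (fun μ => |x μ|) := by
  have key : spAct ((Equiv.refl _, fun μ => if 0 ≤ x μ then (1 : ℤˣ) else -1) : SgnPermPair d) x = fun μ => |x μ| := by
    funext μ
    rw [spAct_apply]
    simp only [Equiv.refl_apply]
    split_ifs with h0
    · rw [Units.val_one, one_mul, abs_of_nonneg h0]
    · rw [Units.val_neg, Units.val_one, neg_one_mul, abs_of_neg (not_le.mp h0)]
  have h := hI (Equiv.refl _, fun μ => if 0 ≤ x μ then (1 : ℤˣ) else -1) x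
  rw [key] at h
  exact h.symm

/-! ### §3  The shell `‖x‖₁ = 2`: two orbits -/

/-- A lattice point with `‖x‖₁ = 2` is `±2e_κ` or `±e_i ± e_j` (`i ≠ j`), read off `|x|`. [cite: FitznerVanDerHofstad2016NoBLE, §3.3.5 p. 1079 (lowest-order points)] -/
theorem shell_two_structure (x : Fin d → ℤ) (hx : ∑ j, |x j| = 2) :
    (∃ κ : Fin d, (fun μ => |x μ|) = axisVec κ 2) ∨
    (∃ i j : Fin d, i ≠ j ∧ (fun μ => |x μ|) = axisVec i 1 + axisVec j 1) := by
  have hx0 : x ≠ 0 := by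
    rintro rfl
    simp at hx
  rcases two_le_suppCount_or_axis x hx0 with h2 | ⟨κ, a, _, rfl⟩
  · right
    have h2' : 1 < (univ.filter fun μ : Fin d => x μ ≠ 0).card := h2
    obtain ⟨i, hi, j, hj, hij⟩ := Finset.one_lt_card.mp h2'
    have hxi : x i ≠ 0 := (Finset.mem_filter.mp hi).2
    have hxj : x j ≠ 0 := (Finset.mem_filter.mp hj).2
    have hjm : j ∈ univ.erase i := Finset.mem_erase.mpr ⟨hij.symm, Finset.mem_univ j⟩
    have hsum : ∑ μ, |x μ| = |x i| + (|x j| + ∑ μ ∈ (univ.erase i).erase j, |x μ|) := by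
      rw [← Finset.add_sum_erase _ _ (Finset.mem_univ i), ← Finset.add_sum_erase _ _ hjm]
    have h1i := Int.one_le_abs hxi
    have h1j := Int.one_le_abs hxj
    have hrest0 : 0 ≤ ∑ μ ∈ (univ.erase i).erase j, |x μ| := Finset.sum_nonneg fun μ _ => abs_nonneg _
    have hai : |x i| = 1 := by omega
    have haj : |x j| = 1 := by omega
    have hrest : ∑ μ ∈ (univ.erase i).erase j, |x μ| = 0 := by omega
    have hzero : ∀ μ, μ ≠ i → μ ≠ j → x μ = 0 := by
      intro μ hμi hμj
      have hmem : μ ∈ (univ.erase i).erase j := Finset.mem_erase.mpr ⟨hμj, Finset.mem_erase.mpr ⟨hμi, Finset.mem_univ μ⟩⟩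
      exact abs_eq_zero.mp ((Finset.sum_eq_zero_iff_of_nonneg fun μ _ => abs_nonneg (x μ)).mp hrest μ hmem)
    refine ⟨i, j, hij, funext fun μ => ?_⟩
    rw [Pi.add_apply, axisVec_apply', axisVec_apply']
    by_cases hμi : μ = i
    · subst hμi; rw [if_pos rfl, if_neg hij, add_zero, hai]
    · by_cases hμj : μ = j
      · subst hμj; rw [if_neg hμi, if_pos rfl, zero_add, haj]
      · rw [if_neg hμi, if_neg hμj, add_zero, hzero μ hμi hμj, abs_zero]
  · left
    rw [sum_abs_axisVec] at hx
    refine ⟨κ, funext fun μ => ?_⟩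
    rw [axisVec_apply', axisVec_apply']
    split_ifs
    · exact hx
    · exact abs_zero

/-- **The shell `‖x‖₁ = 2` consists of the two `W_d`-orbits of `2e₁` and `e₁+e₂`**: every `W_d`-invariant function takes at `x` its value at
`vecOfParts d [2] = 2e₁` or its value at `classVec d 2 0 = e₁+e₂` (the SAME alternative for all `F`).
[cite: FitznerVanDerHofstad2016NoBLE, §3.3.5 p. 1079 (lowest-order points of `𝒳`); (3.35) p. 1071] -/
theorem shell_two_orbit (hd : 2 ≤ d) {x : Fin d → ℤ} (hx : ∑ j, |x j| = 2) :
    (∀ F : (Fin d → ℤ) → ℝ, SpInvariant F → F x = F (vecOfParts d [2])) ∨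
    (∀ F : (Fin d → ℤ) → ℝ, SpInvariant F → F x = F (classVec d 2 0)) := by
  rcases shell_two_structure x hx with ⟨κ, hκ⟩ | ⟨i, j, hij, hij'⟩
  · left
    intro F hI
    rw [eq_abs_of_spInvariant hI x, hκ, vecOfParts_single_eq_axisVec (by omega : 1 ≤ d) 2]
    push_cast
    exact axisVec_eq_of_spInvariant hI κ _ 2
  · right
    intro F hI
    rw [eq_abs_of_spInvariant hI x, hij', classVec_two_zero_eq_axisVec hd]
    exact axisVec_add_axisVec_eq_of_spInvariant hI hij (by simp [Fin.ext_iff]) 1 1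

/-- On the shell a `W_d`-invariant `F` is bounded by its two node values. [cite: FitznerVanDerHofstad2016NoBLE, §3.3.5 p. 1079; (3.35) p. 1071] -/
theorem le_of_sum_abs_eq_two {F : (Fin d → ℤ) → ℝ} (hI : SpInvariant F) (hd : 2 ≤ d) {B : ℝ}
    (h2 : F (vecOfParts d [2]) ≤ B) (h11 : F (classVec d 2 0) ≤ B) {x : Fin d → ℤ} (hx : ∑ j, |x j| = 2) : F x ≤ B := by
  rcases shell_two_orbit hd hx with h | h
  · rw [h F hI]; exact h2
  · rw [h F hI]; exact h11

/-! ### §4  The far cell `Q = {‖x‖₁ ≥ 3}`: three nodes for `I` -/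

/-- **`I_{n,l}` on `Q`** (`n ≥ 1`, `d ≥ 2n+1`): `I_{n,l}(x) ≤ max (I(3e₁)) (max (I(2e₁+e₂)) (I(e₁+e₂+e₃)))` for `‖x‖₁ ≥ 3`.
[cite: FitznerVanDerHofstad2016NoBLE, Lemma 5.1 and §5.1 p. 1093 ("minimal elements of `Q`")] [cite: HaraSlade1992b, App. B, Lemma B.4] -/
theorem srwI_le_max3_of_three_le_sum_abs {n : ℕ} (hn : 1 ≤ n) (hd : 2 * n + 1 ≤ d) (l : ℕ) (x : Fin d → ℤ)
    (hx : 3 ≤ ∑ j, |x j|) :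
    srwI d n l x ≤ max (srwI d n l (vecOfParts d [3])) (max (srwI d n l (vecOfParts d [2, 1])) (srwI d n l (classVec d 3 0))) := by
  have hF := absMonotone_srwI hn hd l
  refine le_of_nodeBounds_three _ (spInvariant_srwI n l) (sortedAntitone_srwI hn hd l) _ (le_max_left _ _)
    (le_max_of_le_right (le_max_left _ _)) ?_ ?_ x hx
  · refine le_trans (hF _ _ fun μ => ?_) (le_max_of_le_right (le_max_left _ _))
    rw [vecOfParts_pair_apply, vecOfParts_pair_apply]
    split_ifs <;> simp
  · intro r hr _
    exact (classVec_le_classVec_of_absMonotone hF hr).trans (le_max_of_le_right (le_max_right _ _))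

/-- Read form on `Q`: `I_{n,l}(x) ≤ B` from the three node inequalities. [cite: FitznerVanDerHofstad2016NoBLE, Lemma 5.1 and §5.1 p. 1093] -/
theorem srwI_le_of_nodeBounds_Q {n : ℕ} (hn : 1 ≤ n) (hd : 2 * n + 1 ≤ d) (l : ℕ) {B : ℝ}
    (h3 : srwI d n l (vecOfParts d [3]) ≤ B) (h21 : srwI d n l (vecOfParts d [2, 1]) ≤ B) (h111 : srwI d n l (classVec d 3 0) ≤ B)
    {x : Fin d → ℤ} (hx : 3 ≤ ∑ j, |x j|) : srwI d n l x ≤ B :=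
  (srwI_le_max3_of_three_le_sum_abs hn hd l x hx).trans (max_le h3 (max_le h21 h111))

namespace F3Bounds

variable {afmin afmax : ℝ}

/-! ### §2 bis  `W_d`-invariance of `boundHD75` at the true tables -/

/-- The true tables frozen at `σx` and at `x` coincide. [cite: FitznerVanDerHofstad2016NoBLE, (3.35)–(3.38) p. 1071; (3.30) p. 1070] -/
theorem srwTrue_frozenAt_spAct (τ : SgnPermPair d) (x : Fin d → ℤ) :
    (srwTrue d afmin afmax).frozenAt (spAct τ x) = (srwTrue d afmin afmax).frozenAt x := by
  have hIM : ∀ (m : ℤ) (l : ℕ), (srwTrue d afmin afmax).IM m l (spAct τ x) = (srwTrue d afmin afmax).IM m l x := by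
    intro m l
    rcases m with m | k
    · rw [Int.ofNat_eq_natCast, srwTrue_IM_natCast, srwTrue_IM_natCast, srwJ_spAct, srwI_spAct, spInvariant_srwIShift2]
    · rw [srwTrue_IM_negSucc, srwTrue_IM_negSucc, srwTrue_IM_negOne, srwTrue_IM_negOne, srwI_spAct, srwI_spAct,
        spInvariant_srwIShift2]
  simp only [Tables.frozenAt, hIM, srwTrue_T, srwTrue_U, srwTrue_K, srwTS_spAct, srwU_spAct, srwK_spAct]

/-- **`boundHD75` at the true tables is `W_d`-invariant in the node.** [cite: FitznerVanDerHofstad2016NoBLE, §3.3.5 (3.71)–(3.87); (3.35)–(3.38) p. 1071] -/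
theorem boundHD75_srwTrue_spAct (n l : ℕ) (τ : SgnPermPair d) (x : Fin d → ℤ) (a : Args) :
    boundHD75 (srwTrue d afmin afmax) n l (spAct τ x) a = boundHD75 (srwTrue d afmin afmax) n l x a := by
  rw [boundHD75_eq_frozenAt (srwTrue d afmin afmax) (v := spAct τ x), boundHD75_eq_frozenAt (srwTrue d afmin afmax) (v := x),
    srwTrue_frozenAt_spAct]
  rfl

/-- `x ↦ boundHD75 (srwTrue d α̲ ᾱ) n l x a` is `W_d`-invariant. [cite: FitznerVanDerHofstad2016NoBLE, §3.3.5 (3.71)–(3.87); (3.35)–(3.38)] -/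
theorem spInvariant_boundHD75_srwTrue (n l : ℕ) (a : Args) :
    SpInvariant (fun x => boundHD75 (srwTrue d afmin afmax) n l x a) := fun τ x => boundHD75_srwTrue_spAct n l τ x a

/-! ### §3 bis  The shell pointwise and the split of `𝒳` -/

/-- **The shell `‖x‖₁ = 2` POINTWISE**: the cell inequality on the shell from its two values at `2e₁` and `e₁+e₂`.
[cite: FitznerVanDerHofstad2016NoBLE, §3.3.5 (3.87) p. 1079] [cite: FitznerVanDerHofstad2017, §2.5, notebook Percolation.nb (points `‖x‖₁ ≤ 2` of `𝒳`)] -/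
theorem boundHD75_srwTrue_shell_le (hd : 2 ≤ d) {n l : ℕ} {a : Args} {b : ℝ}
    (h2 : boundHD75 (srwTrue d afmin afmax) n l (vecOfParts d [2]) a ≤ b)
    (h11 : boundHD75 (srwTrue d afmin afmax) n l (classVec d 2 0) a ≤ b) :
    ∀ x : Fin d → ℤ, ∑ j, |x j| = 2 → boundHD75 (srwTrue d afmin afmax) n l x a ≤ b := fun _ hx =>
  le_of_sum_abs_eq_two (spInvariant_boundHD75_srwTrue n l a) hd h2 h11 hx

/-- **The cell over `𝒳` from the two near values and the far cell `Q`.**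
[cite: FitznerVanDerHofstad2016NoBLE, §3.3.5 (3.87) p. 1079; §5.1 p. 1093] [cite: FitznerVanDerHofstad2017, §2.5, notebook Percolation.nb] -/
theorem boundHD75_srwTrue_calX_le_of_nodes_of_Q (hd : 2 ≤ d) {n l : ℕ} {a : Args} {b : ℝ}
    (h2 : boundHD75 (srwTrue d afmin afmax) n l (vecOfParts d [2]) a ≤ b)
    (h11 : boundHD75 (srwTrue d afmin afmax) n l (classVec d 2 0) a ≤ b)
    (hQ : ∀ x : Fin d → ℤ, 3 ≤ ∑ j, |x j| → boundHD75 (srwTrue d afmin afmax) n l x a ≤ b) :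
    ∀ x ∈ calX d, boundHD75 (srwTrue d afmin afmax) n l x a ≤ b :=
  forall_mem_calX_iff_shell_and_Q.mpr ⟨boundHD75_srwTrue_shell_le hd h2 h11, hQ⟩

/-! ### §5  Generic-cell and at-a-node forms of the cell theorems -/

/-- **Cell `(0,l)` over an arbitrary set `C`** from entrywise sup hypotheses over `C` (IM rows in the shapes of `srwTrue_IM_natCast_le` /
`srwTrue_IM_negOne_le`) and `boundHD75 (Tables.cell IMc Tc Uc Kc) 0 l 0 a ≤ b`.
[cite: FitznerVanDerHofstad2016NoBLE, §3.3.5 (3.87) p. 1079; (3.71)–(3.86)] -/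
theorem boundHD75_srwTrue_zero_le_on (hd : 1 ≤ d) (hα : 0 < afmin) {a : Args} (ha : a.WF) (C : Set (Fin d → ℤ))
    {IMc : ℤ → ℕ → ℝ} {Tc Uc Kc : ℕ → ℕ → ℝ} {l : ℕ} {b : ℝ}
    (hJ0 : ∀ x ∈ C, srwJ d 2 l x ≤ IMc 0 l) (hI0 : ∀ x ∈ C, srwI d 3 l x ≤ d * afmin * IMc 0 l)
    (hS0 : ∀ x ∈ C, (afmax - 1) * srwIShift2 d 3 l x ≤ 2 * (d : ℝ) ^ 2 * IMc 0 l)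
    (hJ0' : ∀ x ∈ C, srwJ d 2 (l + 1) x ≤ IMc 0 (l + 1)) (hI0' : ∀ x ∈ C, srwI d 3 (l + 1) x ≤ d * afmin * IMc 0 (l + 1))
    (hS0' : ∀ x ∈ C, (afmax - 1) * srwIShift2 d 3 (l + 1) x ≤ 2 * (d : ℝ) ^ 2 * IMc 0 (l + 1))
    (hN1 : ∀ x ∈ C, srwI d 1 (l + 1) x + srwIShift2 d 2 l x / (2 * (d : ℝ) ^ 2 * afmin) ≤ IMc (-1) l)
    (hN2 : ∀ x ∈ C, srwI d 2 l x ≤ d * afmin * IMc (-1) l)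
    (hT2 : ∀ x ∈ C, srwTS d afmin 2 l x ≤ Tc 2 l) (hT2' : ∀ x ∈ C, srwTS d afmin 2 (l + 1) x ≤ Tc 2 (l + 1))
    (hT1 : ∀ x ∈ C, srwTS d afmin 1 l x ≤ Tc 1 l)
    (hU2 : ∀ x ∈ C, srwU d 2 l x ≤ Uc 2 l) (hU3 : ∀ x ∈ C, srwU d 3 l x ≤ Uc 3 l)
    (hK1 : ∀ x ∈ C, srwK d 1 l x ≤ Kc 1 l) (hK2 : ∀ x ∈ C, srwK d 2 l x ≤ Kc 2 l)
    (hnum : boundHD75 (Tables.cell IMc Tc Uc Kc : Tables (Fin d → ℤ)) 0 l 0 a ≤ b) :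
    ∀ x ∈ C, boundHD75 (srwTrue d afmin afmax) 0 l x a ≤ b := by
  intro x hx
  refine le_trans ?_ ((boundHD75_cell_irrel IMc Tc Uc Kc 0 l x 0 a).le.trans hnum)
  exact boundHD75_zero_le_of_entries ha
    (srwTrue_IM_natCast_le hd hα (hJ0 x hx) (hI0 x hx) (hS0 x hx))
    (srwTrue_IM_natCast_le hd hα (hJ0' x hx) (hI0' x hx) (hS0' x hx))
    (srwTrue_IM_negOne_le hd hα (hN1 x hx) (hN2 x hx))
    (hT2 x hx) (hT2' x hx) (hT1 x hx) (hU2 x hx) (hU3 x hx) (hK1 x hx) (hK2 x hx)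

/-- **Cells `(1,l)` over an arbitrary set `C`** from entrywise sup hypotheses over `C` and `boundHD75 (Tables.cell IMc Tc Uc Kc) 1 l 0 a ≤ b`.
[cite: FitznerVanDerHofstad2016NoBLE, §3.3.5 (3.87) p. 1079; (3.71)–(3.86)] -/
theorem boundHD75_srwTrue_one_le_on (hd : 1 ≤ d) (hα : 0 < afmin) {a : Args} (ha : a.WF) (C : Set (Fin d → ℤ))
    {IMc : ℤ → ℕ → ℝ} {Tc Uc Kc : ℕ → ℕ → ℝ} {l : ℕ} {b : ℝ}
    (hJ1 : ∀ x ∈ C, srwJ d 3 l x ≤ IMc 1 l) (hI1 : ∀ x ∈ C, srwI d 4 l x ≤ d * afmin * IMc 1 l)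
    (hS1 : ∀ x ∈ C, (afmax - 1) * srwIShift2 d 4 l x ≤ 2 * (d : ℝ) ^ 2 * IMc 1 l)
    (hJ0 : ∀ x ∈ C, srwJ d 2 l x ≤ IMc 0 l) (hI0 : ∀ x ∈ C, srwI d 3 l x ≤ d * afmin * IMc 0 l)
    (hS0 : ∀ x ∈ C, (afmax - 1) * srwIShift2 d 3 l x ≤ 2 * (d : ℝ) ^ 2 * IMc 0 l)
    (hJ1' : ∀ x ∈ C, srwJ d 3 (l + 1) x ≤ IMc 1 (l + 1)) (hI1' : ∀ x ∈ C, srwI d 4 (l + 1) x ≤ d * afmin * IMc 1 (l + 1))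
    (hS1' : ∀ x ∈ C, (afmax - 1) * srwIShift2 d 4 (l + 1) x ≤ 2 * (d : ℝ) ^ 2 * IMc 1 (l + 1))
    (hJ0' : ∀ x ∈ C, srwJ d 2 (l + 1) x ≤ IMc 0 (l + 1)) (hI0' : ∀ x ∈ C, srwI d 3 (l + 1) x ≤ d * afmin * IMc 0 (l + 1))
    (hS0' : ∀ x ∈ C, (afmax - 1) * srwIShift2 d 3 (l + 1) x ≤ 2 * (d : ℝ) ^ 2 * IMc 0 (l + 1))
    (hJ1'' : ∀ x ∈ C, srwJ d 3 (l + 2) x ≤ IMc 1 (l + 2)) (hI1'' : ∀ x ∈ C, srwI d 4 (l + 2) x ≤ d * afmin * IMc 1 (l + 2))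
    (hS1'' : ∀ x ∈ C, (afmax - 1) * srwIShift2 d 4 (l + 2) x ≤ 2 * (d : ℝ) ^ 2 * IMc 1 (l + 2))
    (hT3 : ∀ x ∈ C, srwTS d afmin 3 l x ≤ Tc 3 l) (hT3' : ∀ x ∈ C, srwTS d afmin 3 (l + 1) x ≤ Tc 3 (l + 1))
    (hT2 : ∀ x ∈ C, srwTS d afmin 2 l x ≤ Tc 2 l)
    (hU3 : ∀ x ∈ C, srwU d 3 l x ≤ Uc 3 l) (hU4 : ∀ x ∈ C, srwU d 4 l x ≤ Uc 4 l)
    (hK2 : ∀ x ∈ C, srwK d 2 l x ≤ Kc 2 l) (hK3 : ∀ x ∈ C, srwK d 3 l x ≤ Kc 3 l)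
    (hnum : boundHD75 (Tables.cell IMc Tc Uc Kc : Tables (Fin d → ℤ)) 1 l 0 a ≤ b) :
    ∀ x ∈ C, boundHD75 (srwTrue d afmin afmax) 1 l x a ≤ b := by
  intro x hx
  refine le_trans ?_ ((boundHD75_cell_irrel IMc Tc Uc Kc 1 l x 0 a).le.trans hnum)
  exact boundHD75_one_le_of_entries ha
    (srwTrue_IM_natCast_le hd hα (hJ1 x hx) (hI1 x hx) (hS1 x hx))
    (srwTrue_IM_natCast_le hd hα (hJ0 x hx) (hI0 x hx) (hS0 x hx))
    (srwTrue_IM_natCast_le hd hα (hJ1' x hx) (hI1' x hx) (hS1' x hx))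
    (srwTrue_IM_natCast_le hd hα (hJ0' x hx) (hI0' x hx) (hS0' x hx))
    (srwTrue_IM_natCast_le hd hα (hJ1'' x hx) (hI1'' x hx) (hS1'' x hx))
    (hT3 x hx) (hT3' x hx) (hT2 x hx) (hU3 x hx) (hU4 x hx) (hK2 x hx) (hK3 x hx)

/-- **Cell `(0,l)` AT ONE NODE `y`** from the entry values at `y` and `boundHD75 (Tables.cell IMc Tc Uc Kc) 0 l 0 a ≤ b`.
[cite: FitznerVanDerHofstad2016NoBLE, §3.3.5 (3.87) p. 1079; (3.71)–(3.86)] [cite: FitznerVanDerHofstad2017, §2.5, notebook Percolation.nb] -/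
theorem boundHD75_srwTrue_zero_at_le (hd : 1 ≤ d) (hα : 0 < afmin) {a : Args} (ha : a.WF) (y : Fin d → ℤ)
    {IMc : ℤ → ℕ → ℝ} {Tc Uc Kc : ℕ → ℕ → ℝ} {l : ℕ} {b : ℝ}
    (hJ0 : srwJ d 2 l y ≤ IMc 0 l) (hI0 : srwI d 3 l y ≤ d * afmin * IMc 0 l)
    (hS0 : (afmax - 1) * srwIShift2 d 3 l y ≤ 2 * (d : ℝ) ^ 2 * IMc 0 l)
    (hJ0' : srwJ d 2 (l + 1) y ≤ IMc 0 (l + 1)) (hI0' : srwI d 3 (l + 1) y ≤ d * afmin * IMc 0 (l + 1))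
    (hS0' : (afmax - 1) * srwIShift2 d 3 (l + 1) y ≤ 2 * (d : ℝ) ^ 2 * IMc 0 (l + 1))
    (hN1 : srwI d 1 (l + 1) y + srwIShift2 d 2 l y / (2 * (d : ℝ) ^ 2 * afmin) ≤ IMc (-1) l)
    (hN2 : srwI d 2 l y ≤ d * afmin * IMc (-1) l)
    (hT2 : srwTS d afmin 2 l y ≤ Tc 2 l) (hT2' : srwTS d afmin 2 (l + 1) y ≤ Tc 2 (l + 1)) (hT1 : srwTS d afmin 1 l y ≤ Tc 1 l)
    (hU2 : srwU d 2 l y ≤ Uc 2 l) (hU3 : srwU d 3 l y ≤ Uc 3 l) (hK1 : srwK d 1 l y ≤ Kc 1 l) (hK2 : srwK d 2 l y ≤ Kc 2 l)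
    (hnum : boundHD75 (Tables.cell IMc Tc Uc Kc : Tables (Fin d → ℤ)) 0 l 0 a ≤ b) :
    boundHD75 (srwTrue d afmin afmax) 0 l y a ≤ b := by
  refine le_trans ?_ ((boundHD75_cell_irrel IMc Tc Uc Kc 0 l y 0 a).le.trans hnum)
  exact boundHD75_zero_le_of_entries ha (srwTrue_IM_natCast_le hd hα hJ0 hI0 hS0)
    (srwTrue_IM_natCast_le hd hα hJ0' hI0' hS0') (srwTrue_IM_negOne_le hd hα hN1 hN2) hT2 hT2' hT1 hU2 hU3 hK1 hK2

/-- **Cells `(1,l)` AT ONE NODE `y`** from the entry values at `y` and `boundHD75 (Tables.cell IMc Tc Uc Kc) 1 l 0 a ≤ b`.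
[cite: FitznerVanDerHofstad2016NoBLE, §3.3.5 (3.87) p. 1079; (3.71)–(3.86)] [cite: FitznerVanDerHofstad2017, §2.5, notebook Percolation.nb] -/
theorem boundHD75_srwTrue_one_at_le (hd : 1 ≤ d) (hα : 0 < afmin) {a : Args} (ha : a.WF) (y : Fin d → ℤ)
    {IMc : ℤ → ℕ → ℝ} {Tc Uc Kc : ℕ → ℕ → ℝ} {l : ℕ} {b : ℝ}
    (hJ1 : srwJ d 3 l y ≤ IMc 1 l) (hI1 : srwI d 4 l y ≤ d * afmin * IMc 1 l)
    (hS1 : (afmax - 1) * srwIShift2 d 4 l y ≤ 2 * (d : ℝ) ^ 2 * IMc 1 l)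
    (hJ0 : srwJ d 2 l y ≤ IMc 0 l) (hI0 : srwI d 3 l y ≤ d * afmin * IMc 0 l)
    (hS0 : (afmax - 1) * srwIShift2 d 3 l y ≤ 2 * (d : ℝ) ^ 2 * IMc 0 l)
    (hJ1' : srwJ d 3 (l + 1) y ≤ IMc 1 (l + 1)) (hI1' : srwI d 4 (l + 1) y ≤ d * afmin * IMc 1 (l + 1))
    (hS1' : (afmax - 1) * srwIShift2 d 4 (l + 1) y ≤ 2 * (d : ℝ) ^ 2 * IMc 1 (l + 1))
    (hJ0' : srwJ d 2 (l + 1) y ≤ IMc 0 (l + 1)) (hI0' : srwI d 3 (l + 1) y ≤ d * afmin * IMc 0 (l + 1))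
    (hS0' : (afmax - 1) * srwIShift2 d 3 (l + 1) y ≤ 2 * (d : ℝ) ^ 2 * IMc 0 (l + 1))
    (hJ1'' : srwJ d 3 (l + 2) y ≤ IMc 1 (l + 2)) (hI1'' : srwI d 4 (l + 2) y ≤ d * afmin * IMc 1 (l + 2))
    (hS1'' : (afmax - 1) * srwIShift2 d 4 (l + 2) y ≤ 2 * (d : ℝ) ^ 2 * IMc 1 (l + 2))
    (hT3 : srwTS d afmin 3 l y ≤ Tc 3 l) (hT3' : srwTS d afmin 3 (l + 1) y ≤ Tc 3 (l + 1)) (hT2 : srwTS d afmin 2 l y ≤ Tc 2 l)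
    (hU3 : srwU d 3 l y ≤ Uc 3 l) (hU4 : srwU d 4 l y ≤ Uc 4 l) (hK2 : srwK d 2 l y ≤ Kc 2 l) (hK3 : srwK d 3 l y ≤ Kc 3 l)
    (hnum : boundHD75 (Tables.cell IMc Tc Uc Kc : Tables (Fin d → ℤ)) 1 l 0 a ≤ b) :
    boundHD75 (srwTrue d afmin afmax) 1 l y a ≤ b := by
  refine le_trans ?_ ((boundHD75_cell_irrel IMc Tc Uc Kc 1 l y 0 a).le.trans hnum)
  exact boundHD75_one_le_of_entries ha (srwTrue_IM_natCast_le hd hα hJ1 hI1 hS1) (srwTrue_IM_natCast_le hd hα hJ0 hI0 hS0)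
    (srwTrue_IM_natCast_le hd hα hJ1' hI1' hS1') (srwTrue_IM_natCast_le hd hα hJ0' hI0' hS0')
    (srwTrue_IM_natCast_le hd hα hJ1'' hI1'' hS1'') hT3 hT3' hT2 hU3 hU4 hK2 hK3

end F3Bounds

end Literature.Probability.FitznerVanDerHofstad2017

end
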